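import Summits.QuantumAdvantage.QuantumAdvantage.Theorems.SosSandwichPseudoBoundedAALevelKDecoupling
import HarnessLib

/-!
# Route `SosSandwich`, crux `PseudoBoundedAA` (stmt-QuantumAdvantage-15237): level-`k` rows — Khintchine from
# Bonami at level `m`, the Euler identity, the uniform row-sum bound

Part 2 of the LEVEL-`k` RUNG of the AA ladder (part 1: `…LevelKDecoupling.lean`; part 3, the rung itself:
`…LevelKRung.lean`).  For a cube function `g` write `∂_i F(u) = Σ_{S ∋ i, |S| = k} ĝ(S) χ_{S∖i}(u)` for the rows of
its level-`k` part.

* §1 `sq_sum_le_of_isLevelLE` — **Khintchine from Bonami at level `m`**: `(Σ_u h²)·2^N ≤ 9^m (Σ_u |h|)²` for every `h`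
  of Fourier level `≤ m` (two Cauchy–Schwarz steps + the tree's `IsLevelLE.bonami_even_moment`).
* §2 `sum_sgn_mul_row_eq` — the Euler identity `Σ_i χ(σ_i) ∂_i F(u) = Σ_{|S|=k} ĝ(S)χ_S(u)(2|S ∩ J| - k)`,
  `J = {σ = u}`; `sum_abs_row_le` — hence `Σ_i |∂_i F(u)| ≤ (2k² + k)·L` whenever the level-`k` part is
  `L`-bounded (part 1's decoupling bound).
* §3 `sum_sq_row_eq` (Parseval for a row), `isLevelLE_row` (a row has level `≤ k-1`), `khintchine_row`
  (`2^N·r_i ≤ 3^{k-1}·Σ_u |∂_i F(u)|`, `r_i² = Σ_{S∋i,|S|=k} ĝ(S)²`).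

Honest label: support lemmas; no stub, crux or summit is proved.  Sources: O'Donnell 2014 Thm. 9.21, §1.4;
Littlewood 1930; Korneichuk 1991 §3.5.4.
-/

-- D-0017: single-conjunct summit ⇒ the duplicate `QuantumAdvantage.QuantumAdvantage` is mandated.
set_option linter.dupNamespace false

noncomputable section

namespace Summit.QuantumAdvantage.QuantumAdvantage.Theorems.SosSandwich.LevelKRung

open Finset
open Literature.Computability.QuantumComplexity
open Literature.Computability.Complexity.LowDegree (cubeFourierCoeff sum_cubeFourierCoeff_mul_walsh
  sum_walsh_mul_walsh_index IsLevelLE isLevelLE_walsh cubeFourierCoeff_sum_mul_walsh)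
open Literature.Probability.RandomGraphs.LowDegree (sgn walsh sgn_true sgn_false walsh_empty)
open Summit.QuantumAdvantage.QuantumAdvantage.Theorems.SosSandwich.LevelOneRung

variable {N : ℕ}

/-! ### §1 Khintchine from Bonami at level `m` -/

/-- **Hölder step at level `≤ m`**: `(Σ_u h²)·2^N ≤ 9^m·(Σ_u |h|)²` (`E h² ≤ (E|h|)^{2/3}(E h⁴)^{1/3}` by two
Cauchy–Schwarz steps and Bonami's `E h⁴ ≤ 9^m (E h²)²`). [cite: ODonnell2014, Thm. 9.21 and §9.1] -/
theorem sq_sum_le_of_isLevelLE {m : ℕ} (h : (Fin N → Bool) → ℝ) (hh : IsLevelLE m h) :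
    (∑ u, h u ^ 2) * (2 : ℝ) ^ N ≤ (9 : ℝ) ^ m * (∑ u, |h u|) ^ 2 := by
  have h2N : (0 : ℝ) < (2 : ℝ) ^ N := by positivity
  have hB := hh.bonami_even_moment 2 (by norm_num)
  have h9 : (2 * ((2 : ℕ) : ℝ) - 1) ^ (2 * m) = (9 : ℝ) ^ m := by norm_num [pow_mul]
  rw [h9] at hB
  set S2 := ∑ u, h u ^ 2 with hS2
  set S1 := ∑ u, |h u| with hS1
  set S3 := ∑ u, |h u| ^ 3 with hS3
  set S4 := ∑ u, (h u ^ 2) ^ 2 with hS4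
  have h9m : (0 : ℝ) < (9 : ℝ) ^ m := by positivity
  have hS2nn : 0 ≤ S2 := Finset.sum_nonneg fun u _ => sq_nonneg _
  have hS1nn : 0 ≤ S1 := Finset.sum_nonneg fun u _ => abs_nonneg _
  have h4 : S4 * (2 : ℝ) ^ N ≤ (9 : ℝ) ^ m * S2 ^ 2 := by
    rw [div_le_iff₀ h2N] at hB
    have e : (9 : ℝ) ^ m * (S2 / (2 : ℝ) ^ N) ^ 2 * (2 : ℝ) ^ N = (9 : ℝ) ^ m * S2 ^ 2 / (2 : ℝ) ^ N := by
      field_simp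
    rw [e, le_div_iff₀ h2N] at hB
    exact hB
  have cs1 : S2 ^ 2 ≤ S1 * S3 := by
    have := Finset.sum_mul_sq_le_sq_mul_sq univ (fun u => Real.sqrt |h u|) (fun u => |h u| * Real.sqrt |h u|)
    have e1 : ∀ u, Real.sqrt |h u| * (|h u| * Real.sqrt |h u|) = h u ^ 2 := fun u => by
      have hs := Real.mul_self_sqrt (abs_nonneg (h u))
      calc Real.sqrt |h u| * (|h u| * Real.sqrt |h u|)
          = (Real.sqrt |h u| * Real.sqrt |h u|) * |h u| := by ring
        _ = |h u| * |h u| := by rw [hs]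
        _ = h u ^ 2 := by rw [← sq, sq_abs]
    have e2 : ∀ u, Real.sqrt |h u| ^ 2 = |h u| := fun u => Real.sq_sqrt (abs_nonneg _)
    have e3 : ∀ u, (|h u| * Real.sqrt |h u|) ^ 2 = |h u| ^ 3 := fun u => by
      rw [mul_pow, Real.sq_sqrt (abs_nonneg _)]; ring
    simp_rw [e1, e2, e3] at this
    exact this
  have cs2 : S3 ^ 2 ≤ S2 * S4 := by
    have := Finset.sum_mul_sq_le_sq_mul_sq univ (fun u => |h u|) (fun u => h u ^ 2)
    have e1 : ∀ u, |h u| * h u ^ 2 = |h u| ^ 3 := fun u => by rw [← sq_abs]; ring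
    have e2 : ∀ u, |h u| ^ 2 = h u ^ 2 := fun u => sq_abs _
    simp_rw [e1, e2] at this
    exact this
  by_cases hS2z : S2 = 0
  · rw [hS2z, zero_mul]; positivity
  have hS2pos : 0 < S2 := lt_of_le_of_ne hS2nn (Ne.symm hS2z)
  have i12 : S2 ^ 4 ≤ S1 ^ 2 * (S2 * S4) :=
    calc S2 ^ 4 = (S2 ^ 2) ^ 2 := by ring
      _ ≤ (S1 * S3) ^ 2 := pow_le_pow_left₀ (by positivity) cs1 2
      _ = S1 ^ 2 * S3 ^ 2 := by ring
      _ ≤ S1 ^ 2 * (S2 * S4) := mul_le_mul_of_nonneg_left cs2 (by positivity)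
  have i3 : S2 ^ 4 * (2 : ℝ) ^ N ≤ S1 ^ 2 * S2 * ((9 : ℝ) ^ m * S2 ^ 2) :=
    calc S2 ^ 4 * (2 : ℝ) ^ N ≤ S1 ^ 2 * (S2 * S4) * (2 : ℝ) ^ N := mul_le_mul_of_nonneg_right i12 h2N.le
      _ = S1 ^ 2 * S2 * (S4 * (2 : ℝ) ^ N) := by ring
      _ ≤ S1 ^ 2 * S2 * ((9 : ℝ) ^ m * S2 ^ 2) := mul_le_mul_of_nonneg_left h4 (by positivity)
  have hS23 : 0 < S2 ^ 3 := pow_pos hS2pos 3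
  have hfin : S2 * (2 : ℝ) ^ N * S2 ^ 3 ≤ (9 : ℝ) ^ m * S1 ^ 2 * S2 ^ 3 :=
    calc S2 * (2 : ℝ) ^ N * S2 ^ 3 = S2 ^ 4 * (2 : ℝ) ^ N := by ring
      _ ≤ S1 ^ 2 * S2 * ((9 : ℝ) ^ m * S2 ^ 2) := i3
      _ = (9 : ℝ) ^ m * S1 ^ 2 * S2 ^ 3 := by ring
  exact le_of_mul_le_mul_right hfin hS23

/-! ### §2 Rows of the level-`k` part: the Euler identity and the uniform row-sum bound -/

/-- Reindexing the size-`k` sets through `i` by `S ↦ S ∖ {i}`. [folklore] -/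
theorem sum_filter_card_mem_eq {k : ℕ} (i : Fin N) (f : Finset (Fin N) → ℝ) :
    ∑ S ∈ univ.filter (fun S : Finset (Fin N) => S.card = k ∧ i ∈ S), f S =
      ∑ R ∈ univ.filter (fun R : Finset (Fin N) => i ∉ R ∧ (insert i R).card = k), f (insert i R) := by
  classical
  refine Finset.sum_nbij' (fun S => S.erase i) (fun R => insert i R) ?_ ?_ ?_ ?_ ?_
  · intro S hS
    rw [Finset.mem_filter] at hS ⊢
    refine ⟨Finset.mem_univ _, Finset.notMem_erase i S, ?_⟩
    rw [Finset.insert_erase hS.2.2]; exact hS.2.1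
  · intro R hR
    rw [Finset.mem_filter] at hR ⊢
    exact ⟨Finset.mem_univ _, hR.2.2, Finset.mem_insert_self i R⟩
  · intro S hS
    rw [Finset.mem_filter] at hS
    exact Finset.insert_erase hS.2.2
  · intro R hR
    rw [Finset.mem_filter] at hR
    exact Finset.erase_insert hR.2.1
  · intro S hS
    rw [Finset.mem_filter] at hS
    show f S = f (insert i (S.erase i))
    rw [Finset.insert_erase hS.2.2]

/-- `χ_{S∖i}(u) = χ_S(u) χ_i(u)` for `i ∈ S`. [cite: ODonnell2014, §1.2] -/
theorem walsh_erase_eq {S : Finset (Fin N)} {i : Fin N} (hi : i ∈ S) (u : Fin N → Bool) :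
    walsh (S.erase i) u = walsh S u * sgn (u i) := by
  have h := Finset.mul_prod_erase S (fun j => sgn (u j)) hi
  unfold walsh
  rw [← h]
  have hs : sgn (u i) * sgn (u i) = 1 := Literature.Probability.RandomGraphs.LowDegree.sgn_mul_self _
  calc ∏ x ∈ S.erase i, sgn (u x) = (sgn (u i) * sgn (u i)) * ∏ x ∈ S.erase i, sgn (u x) := by rw [hs, one_mul]
    _ = sgn (u i) * (∏ x ∈ S.erase i, sgn (u x)) * sgn (u i) := by ring

/-- `χ(σ_i)χ(u_i) = +1` if `σ_i = u_i`, `-1` otherwise. [folklore] -/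
theorem sgn_mul_sgn_eq_ite (a b : Bool) : sgn a * sgn b = if a = b then (1 : ℝ) else -1 := by
  cases a <;> cases b <;> simp [sgn]

/-- `Σ_{i ∈ S} (±1 according to i ∈ J) = 2|S ∩ J| - |S|`. [folklore] -/
theorem sum_ite_mem_eq (S J : Finset (Fin N)) :
    ∑ i ∈ S, (if i ∈ J then (1 : ℝ) else -1) = 2 * ((S.filter (· ∈ J)).card : ℝ) - (S.card : ℝ) := by
  rw [Finset.sum_ite, Finset.sum_const, Finset.sum_const, nsmul_eq_mul, nsmul_eq_mul]
  have h := Finset.card_filter_add_card_filter_not (s := S) (fun i => i ∈ J)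
  have h' : ((S.filter (fun i => ¬ i ∈ J)).card : ℝ) = (S.card : ℝ) - ((S.filter (· ∈ J)).card : ℝ) := by
    have : ((S.filter (· ∈ J)).card : ℝ) + ((S.filter (fun i => ¬ i ∈ J)).card : ℝ) = (S.card : ℝ) := by
      exact_mod_cast h
    linarith
  rw [h']; ring

/-- **The Euler identity for the rows of the level-`k` part.**  With `J = {i : σ_i = u_i}`:
`Σ_i χ(σ_i)·(Σ_{S ∋ i, |S| = k} ĝ(S) χ_{S∖i}(u)) = Σ_{|S| = k} ĝ(S) χ_S(u)·(2|S ∩ J| - k)`. [folklore] -/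
theorem sum_sgn_mul_row_eq (g : (Fin N → Bool) → ℝ) (k : ℕ) (σ u : Fin N → Bool) :
    ∑ i, sgn (σ i) * ∑ S ∈ univ.filter (fun S : Finset (Fin N) => S.card = k ∧ i ∈ S),
        cubeFourierCoeff g S * walsh (S.erase i) u =
      ∑ S ∈ univ.filter (fun S : Finset (Fin N) => S.card = k),
        cubeFourierCoeff g S * walsh S u *
          (2 * (((S.filter (· ∈ univ.filter (fun j : Fin N => σ j = u j))).card : ℝ)) - (k : ℝ)) := by
  classical
  set J : Finset (Fin N) := univ.filter (fun j : Fin N => σ j = u j) with hJ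
  -- each signed row as an indicator sum over the size-`k` sets
  have e1 : ∀ i, sgn (σ i) * ∑ S ∈ univ.filter (fun S : Finset (Fin N) => S.card = k ∧ i ∈ S),
      cubeFourierCoeff g S * walsh (S.erase i) u =
      ∑ S ∈ univ.filter (fun S : Finset (Fin N) => S.card = k),
        (if i ∈ S then cubeFourierCoeff g S * walsh S u * (if i ∈ J then (1 : ℝ) else -1) else 0) := by
    intro i
    rw [Finset.mul_sum, Finset.sum_filter, Finset.sum_filter]
    refine Finset.sum_congr rfl fun S _ => ?_
    by_cases hk : S.card = k
    · by_cases hi : i ∈ S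
      · rw [if_pos ⟨hk, hi⟩, if_pos hk, if_pos hi, walsh_erase_eq hi,
          show (if i ∈ J then (1 : ℝ) else -1) = sgn (σ i) * sgn (u i) by
            rw [sgn_mul_sgn_eq_ite]; simp [hJ]]
        ring
      · rw [if_neg (fun h => hi h.2), if_pos hk, if_neg hi]
    · rw [if_neg (fun h => hk h.1), if_neg hk]
  simp_rw [e1]
  rw [Finset.sum_comm]
  refine Finset.sum_congr rfl fun S hS => ?_
  rw [Finset.mem_filter] at hS
  rw [Finset.sum_ite_mem, Finset.univ_inter]
  have : ∑ i ∈ S, cubeFourierCoeff g S * walsh S u * (if i ∈ J then (1 : ℝ) else -1) =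
      cubeFourierCoeff g S * walsh S u * ∑ i ∈ S, (if i ∈ J then (1 : ℝ) else -1) := by
    rw [Finset.mul_sum]
  rw [this, sum_ite_mem_eq, hS.2]

/-- **Uniform row-sum bound.**  If the level-`k` part of `g` (`F = Σ_{|S|=k} ĝ(S) χ_S`) is `L`-bounded in sup norm,
then for every `u`: `Σ_i |Σ_{S ∋ i, |S|=k} ĝ(S) χ_{S∖i}(u)| ≤ (2k² + k)·L` (Euler identity with `σ` = the signs
of the rows; part 1's decoupling bound `k²L` for the weighted sum and `L` for the plain one). [folklore] -/
theorem sum_abs_row_le {k : ℕ} {L : ℝ} {g : (Fin N → Bool) → ℝ}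
    (hL : ∀ z : Fin N → Bool,
      |∑ S ∈ univ.filter (fun S : Finset (Fin N) => S.card = k), cubeFourierCoeff g S * walsh S z| ≤ L)
    (u : Fin N → Bool) :
    ∑ i, |∑ S ∈ univ.filter (fun S : Finset (Fin N) => S.card = k ∧ i ∈ S),
        cubeFourierCoeff g S * walsh (S.erase i) u| ≤ (2 * (k : ℝ) ^ 2 + k) * L := by
  classical
  set row : Fin N → ℝ := fun i => ∑ S ∈ univ.filter (fun S : Finset (Fin N) => S.card = k ∧ i ∈ S),
    cubeFourierCoeff g S * walsh (S.erase i) u with hrow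
  set σ : Fin N → Bool := fun i => decide (row i < 0) with hσ
  have habs : ∀ i, |∑ S ∈ univ.filter (fun S : Finset (Fin N) => S.card = k ∧ i ∈ S),
      cubeFourierCoeff g S * walsh (S.erase i) u| = sgn (σ i) * row i := by
    intro i
    show |row i| = sgn (σ i) * row i
    by_cases hlt : row i < 0
    · have : σ i = true := by simp only [hσ]; exact decide_eq_true hlt
      rw [this, sgn_true, abs_of_neg hlt]; ring
    · have : σ i = false := by simp only [hσ]; exact decide_eq_false hlt
      rw [this, sgn_false, abs_of_nonneg (not_lt.mp hlt), one_mul]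
  simp_rw [habs]
  rw [sum_sgn_mul_row_eq g k σ u]
  -- the coefficients of the level-`k` part
  set c : Finset (Fin N) → ℝ := fun S => if S.card = k then cubeFourierCoeff g S else 0 with hc
  have hcF : ∀ x, ∑ S : Finset (Fin N), c S * walsh S x =
      ∑ S ∈ univ.filter (fun S : Finset (Fin N) => S.card = k), cubeFourierCoeff g S * walsh S x := by
    intro x
    rw [Finset.sum_filter]
    exact Finset.sum_congr rfl fun S _ => by simp only [hc]; split_ifs <;> simp
  have hF : ∀ x, |∑ S : Finset (Fin N), c S * walsh S x| ≤ L := fun x => by rw [hcF]; exact hL x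
  have hck : ∀ S : Finset (Fin N), c S ≠ 0 → S.card ≤ k := by
    intro S hS; simp only [hc] at hS; by_contra h; exact hS (if_neg (by omega))
  set J : Finset (Fin N) := univ.filter (fun j : Fin N => σ j = u j) with hJ
  have hW := abs_weighted_sum_le c hck hF J u
  have hA := hL u
  -- split the Euler sum into `2·(weighted) - k·(plain)`
  have hsplit : ∑ S ∈ univ.filter (fun S : Finset (Fin N) => S.card = k),
      cubeFourierCoeff g S * walsh S u * (2 * (((S.filter (· ∈ J)).card : ℝ)) - (k : ℝ)) =
      2 * ∑ S : Finset (Fin N), c S * walsh S u * ((S.filter (· ∈ J)).card : ℝ) -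
        (k : ℝ) * ∑ S ∈ univ.filter (fun S : Finset (Fin N) => S.card = k), cubeFourierCoeff g S * walsh S u := by
    rw [Finset.mul_sum, Finset.mul_sum, Finset.sum_filter, Finset.sum_filter, ← Finset.sum_sub_distrib]
    refine Finset.sum_congr rfl fun S _ => ?_
    simp only [hc]
    split_ifs <;> ring
  rw [hsplit]
  calc 2 * ∑ S : Finset (Fin N), c S * walsh S u * ((S.filter (· ∈ J)).card : ℝ) -
        (k : ℝ) * ∑ S ∈ univ.filter (fun S : Finset (Fin N) => S.card = k), cubeFourierCoeff g S * walsh S u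
      ≤ 2 * |∑ S : Finset (Fin N), c S * walsh S u * ((S.filter (· ∈ J)).card : ℝ)| +
        (k : ℝ) * |∑ S ∈ univ.filter (fun S : Finset (Fin N) => S.card = k), cubeFourierCoeff g S * walsh S u| := by
          nlinarith [le_abs_self (∑ S : Finset (Fin N), c S * walsh S u * ((S.filter (· ∈ J)).card : ℝ)),
            neg_abs_le (∑ S ∈ univ.filter (fun S : Finset (Fin N) => S.card = k),
              cubeFourierCoeff g S * walsh S u), (Nat.cast_nonneg k : (0 : ℝ) ≤ k)]
    _ ≤ 2 * ((k : ℝ) ^ 2 * L) + (k : ℝ) * L := by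
          gcongr
    _ = (2 * (k : ℝ) ^ 2 + k) * L := by ring

/-! ### §3 Row weights: Parseval identity, level, Khintchine -/

/-- A row as a full Walsh sum with coefficients supported on `R ∌ i`, `|R ∪ {i}| = k`. [folklore] -/
theorem row_eq_sum_walsh (g : (Fin N → Bool) → ℝ) (k : ℕ) (i : Fin N) (u : Fin N → Bool) :
    ∑ S ∈ univ.filter (fun S : Finset (Fin N) => S.card = k ∧ i ∈ S), cubeFourierCoeff g S * walsh (S.erase i) u =
      ∑ R : Finset (Fin N), (if i ∉ R ∧ (insert i R).card = k then cubeFourierCoeff g (insert i R) else 0) *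
        walsh R u := by
  classical
  rw [sum_filter_card_mem_eq i (fun S => cubeFourierCoeff g S * walsh (S.erase i) u)]
  simp_rw [ite_mul, zero_mul]
  rw [← Finset.sum_filter]
  refine Finset.sum_congr rfl fun R hR => ?_
  rw [Finset.mem_filter] at hR
  rw [Finset.erase_insert hR.2.1]

/-- **Parseval for a row**: `Σ_u (∂_i F(u))² = 2^N Σ_{S ∋ i, |S| = k} ĝ(S)²`. [cite: ODonnell2014, §1.4] -/
theorem sum_sq_row_eq (g : (Fin N → Bool) → ℝ) (k : ℕ) (i : Fin N) :
    ∑ u : Fin N → Bool, (∑ S ∈ univ.filter (fun S : Finset (Fin N) => S.card = k ∧ i ∈ S),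
        cubeFourierCoeff g S * walsh (S.erase i) u) ^ 2 =
      (2 : ℝ) ^ N * ∑ S ∈ univ.filter (fun S : Finset (Fin N) => S.card = k ∧ i ∈ S), cubeFourierCoeff g S ^ 2 := by
  classical
  simp_rw [row_eq_sum_walsh]
  rw [sum_sq_sum_mul_walsh, sum_filter_card_mem_eq i (fun S => cubeFourierCoeff g S ^ 2), Finset.sum_filter]
  congr 1
  refine Finset.sum_congr rfl fun R _ => ?_
  split_ifs <;> simp

/-- A row of the level-`k` part has Fourier level `≤ k - 1`. [cite: ODonnell2014, §1.4] -/
theorem isLevelLE_row (g : (Fin N → Bool) → ℝ) (k : ℕ) (i : Fin N) :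
    IsLevelLE (k - 1) (fun u : Fin N → Bool =>
      ∑ S ∈ univ.filter (fun S : Finset (Fin N) => S.card = k ∧ i ∈ S),
        cubeFourierCoeff g S * walsh (S.erase i) u) := by
  classical
  intro T hT
  have heq : (fun u : Fin N → Bool => ∑ S ∈ univ.filter (fun S : Finset (Fin N) => S.card = k ∧ i ∈ S),
      cubeFourierCoeff g S * walsh (S.erase i) u) =
      fun u => ∑ R : Finset (Fin N),
        (if i ∉ R ∧ (insert i R).card = k then cubeFourierCoeff g (insert i R) else 0) * walsh R u :=
    funext fun u => row_eq_sum_walsh g k i u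
  rw [heq, cubeFourierCoeff_sum_mul_walsh]
  rw [if_neg]
  rintro ⟨hiT, hcard⟩
  rw [Finset.card_insert_of_notMem hiT] at hcard
  omega

/-- **Khintchine for a row**: `2^N·r_i ≤ 3^{k-1}·Σ_u |∂_i F(u)|`, `r_i = (Σ_{S∋i,|S|=k} ĝ(S)²)^{1/2}`.
[cite: ODonnell2014, Thm. 9.21] -/
theorem khintchine_row (g : (Fin N → Bool) → ℝ) (k : ℕ) (i : Fin N) :
    (2 : ℝ) ^ N * Real.sqrt (∑ S ∈ univ.filter (fun S : Finset (Fin N) => S.card = k ∧ i ∈ S),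
        cubeFourierCoeff g S ^ 2) ≤
      (3 : ℝ) ^ (k - 1) * ∑ u : Fin N → Bool,
        |∑ S ∈ univ.filter (fun S : Finset (Fin N) => S.card = k ∧ i ∈ S),
          cubeFourierCoeff g S * walsh (S.erase i) u| := by
  have key := sq_sum_le_of_isLevelLE _ (isLevelLE_row g k i)
  rw [sum_sq_row_eq] at key
  set W := ∑ S ∈ univ.filter (fun S : Finset (Fin N) => S.card = k ∧ i ∈ S), cubeFourierCoeff g S ^ 2 with hW
  set A := ∑ u : Fin N → Bool, |∑ S ∈ univ.filter (fun S : Finset (Fin N) => S.card = k ∧ i ∈ S),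
    cubeFourierCoeff g S * walsh (S.erase i) u| with hA
  have hW0 : 0 ≤ W := Finset.sum_nonneg fun S _ => sq_nonneg _
  have h93 : (9 : ℝ) ^ (k - 1) = ((3 : ℝ) ^ (k - 1)) ^ 2 := by
    rw [← pow_mul, show (9 : ℝ) = 3 ^ 2 by norm_num, ← pow_mul]; ring_nf
  have hsq : ((2 : ℝ) ^ N * Real.sqrt W) ^ 2 ≤ ((3 : ℝ) ^ (k - 1) * A) ^ 2 :=
    calc ((2 : ℝ) ^ N * Real.sqrt W) ^ 2 = (2 : ℝ) ^ N * W * (2 : ℝ) ^ N := by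
          rw [mul_pow, Real.sq_sqrt hW0]; ring
      _ ≤ (9 : ℝ) ^ (k - 1) * A ^ 2 := key
      _ = ((3 : ℝ) ^ (k - 1) * A) ^ 2 := by rw [h93]; ring
  exact (pow_le_pow_iff_left₀ (by positivity) (by positivity) two_ne_zero).mp hsq

end Summit.QuantumAdvantage.QuantumAdvantage.Theorems.SosSandwich.LevelKRung
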